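import Literature.IUT.LogVolume.LocalUnitLog
import Mathlib.NumberTheory.Padics.RingHoms
import HarnessLib

/-!
# A wildly ramified cubic `3`-adic field `K = ℚ₃(π)`, `π³ = 3`: absolute values and coordinates

Classical local arithmetic (no disputed mathematics; the [IUTchIV] locator records where the abc-iut cell
uses it).  Let `K` be a field which is a normed `ℚ₃`-algebra containing `π` with `π³ = 3`, together with a
`ℚ₃`-basis `B = (1, π, π²)` (so `K = ℚ₃(π) ≅ ℚ₃(∛3)`: totally and WILDLY ramified, `e = p = 3`,
`𝒪_K = ℤ₃[π]`, `𝔪_K = (π)`, residue field `𝔽₃`).  We prove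

* `norm_combo` / `norm_eq_max` — `‖a + bπ + cπ²‖ = max(‖a‖, ‖b‖·‖π‖, ‖c‖·‖π‖²)` (the three summands have
  pairwise distinct absolute values: their cubes are distinct integral powers of `3`);
* the integrality consequences (`‖a‖·‖π‖ < 1 ⇒ a ∈ ℤ₃`, …) and, for the `ℚ₃`-linear functional
  `ψ := B.coord 0 − B.coord 1` (`ψ(a + bπ + cπ²) = a − b`): `ψ(1) = 1`, `ψ(π) = −1`, `ψ(π²) = 0` and
  `‖x‖ ≤ ‖π‖² ⇒ ‖ψ(x)‖ ≤ 1/3` (`ψ(𝔪²) ⊆ 3ℤ₃`).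

Continued in `WildCubicUnitLog.lean` (units, principal units, `log₃(𝒪_K^×) ⊆ ψ⁻¹(3ℤ₃)`) and consumed by
`WildShellObstruction.lean` (the Dupuy–Hilado log-shell of a two-factor packet of such fields does not
contain the normalisation `(R_I)^∼` of [IUTchIV] Prop. 1.1 — kernel form of abc-iut-S1's hand computation,
cell abc-iut STATUS 2026-08-25T23:25:47Z).  Proof-only file (theorems, no definitions).
[cite: NeukirchANT1999, Ch. II (5.5)] [cite: Mochizuki2012, IUTchIV Prop. 1.2 (i)–(ii) p. 10]
-/

noncomputable section

open Metric Set Filter Finset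
open scoped Topology

namespace Literature.IUT.LogVolume

namespace WildCubic

variable {K : Type*} [NontriviallyNormedField K] [NormedAlgebra ℚ_[3] K]

/-! ### Absolute values of `3`, `π`, and of `ℚ₃`-multiples of `1, π, π²` -/

/-- `‖3‖ = 1/3` in a normed `ℚ₃`-algebra. [cite: NeukirchANT1999, Ch. II (5.5)] -/
theorem norm_three : ‖(3 : K)‖ = 3⁻¹ := by
  rw [← map_ofNat (algebraMap ℚ_[3] K) 3, norm_algebraMap']
  simpa using Padic.norm_p (p := 3)

/-- `‖(m : K)‖ = ‖(m : ℚ₃)‖` for a natural number `m`. [cite: NeukirchANT1999, Ch. II (5.5)] -/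
theorem norm_natCast (m : ℕ) : ‖(m : K)‖ = ‖(m : ℚ_[3])‖ := by
  rw [← map_natCast (algebraMap ℚ_[3] K) m, norm_algebraMap']

/-- Lower bound for the absolute value of a nonzero natural number: `‖m‖ ≥ 3^{−v₃(m)}`.
[cite: NeukirchANT1999, Ch. II (5.5)] -/
theorem zpow_neg_padicValNat_le_norm_natCast {m : ℕ} (hm : m ≠ 0) :
    (3 : ℝ) ^ (-(padicValNat 3 m : ℤ)) ≤ ‖(m : K)‖ := by
  rw [norm_natCast]
  have hnd : ¬ 3 ^ (padicValNat 3 m + 1) ∣ m := pow_succ_padicValNat_not_dvd hm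
  have h1 : ¬ ‖((m : ℤ) : ℚ_[3])‖ ≤ ((3 : ℕ) : ℝ) ^ (-((padicValNat 3 m + 1 : ℕ) : ℤ)) := by
    rw [Padic.norm_int_le_pow_iff_dvd]
    exact_mod_cast hnd
  rw [Int.cast_natCast] at h1
  have h2 := not_lt.mp ((Padic.norm_le_pow_iff_norm_lt_pow_add_one (m : ℚ_[3])
    (-((padicValNat 3 m + 1 : ℕ) : ℤ))).not.mp h1)
  have h3 : -((padicValNat 3 m + 1 : ℕ) : ℤ) + 1 = -(padicValNat 3 m : ℤ) := by push_cast; ring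
  rw [h3] at h2
  exact_mod_cast h2

variable {π : K}

/-- `‖π‖³ = 1/3` when `π³ = 3`. [cite: NeukirchANT1999, Ch. II (5.5)] -/
theorem norm_pi_pow_three (hπ : π ^ 3 = 3) : ‖π‖ ^ 3 = 3⁻¹ := by
  rw [← norm_pow, hπ, norm_three]

/-- `0 < ‖π‖`. [cite: NeukirchANT1999, Ch. II (5.5)] -/
theorem norm_pi_pos (hπ : π ^ 3 = 3) : 0 < ‖π‖ := by
  rcases (norm_nonneg π).eq_or_lt with h0 | h0
  · have h := norm_pi_pow_three hπ
    rw [← h0] at h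
    norm_num at h
  · exact h0

/-- `‖π‖ < 1`. [cite: NeukirchANT1999, Ch. II (5.5)] -/
theorem norm_pi_lt_one (hπ : π ^ 3 = 3) : ‖π‖ < 1 := by
  refine lt_of_not_ge fun h => ?_
  have h1 : (1 : ℝ) ≤ ‖π‖ ^ 3 := one_le_pow₀ h
  rw [norm_pi_pow_three hπ] at h1
  norm_num at h1

/-- `‖π‖² < 1`. [cite: NeukirchANT1999, Ch. II (5.5)] -/
theorem norm_pi_sq_lt_one (hπ : π ^ 3 = 3) : ‖π‖ ^ 2 < 1 :=
  pow_lt_one₀ (norm_nonneg π) (norm_pi_lt_one hπ) two_ne_zero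

/-- `1/3 < ‖π‖²` (`1/3 = ‖π‖³`). [cite: NeukirchANT1999, Ch. II (5.5)] -/
theorem third_lt_norm_pi_sq (hπ : π ^ 3 = 3) : (3 : ℝ)⁻¹ < ‖π‖ ^ 2 := by
  rw [← norm_pi_pow_three hπ]
  have h0 := norm_pi_pos hπ
  have h1 := norm_pi_lt_one hπ
  nlinarith [pow_pos h0 2]

/-- `‖π‖^m · 3^s ≤ ‖π‖²` as soon as `m ≥ 3s + 2` (`‖π‖^{3s}·3^s = 1`). [cite: NeukirchANT1999, Ch. II (5.5)] -/
theorem norm_pi_pow_mul_three_pow_le (hπ : π ^ 3 = 3) {m s : ℕ} (h : 3 * s + 2 ≤ m) :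
    ‖π‖ ^ m * (3 : ℝ) ^ s ≤ ‖π‖ ^ 2 := by
  have h0 := (norm_pi_pos hπ).le
  have h1 := (norm_pi_lt_one hπ).le
  have hkey : ‖π‖ ^ (3 * s) * (3 : ℝ) ^ s = 1 := by
    rw [pow_mul, ← mul_pow, norm_pi_pow_three hπ, inv_mul_cancel₀ (by norm_num : (3 : ℝ) ≠ 0),
      one_pow]
  obtain ⟨d, rfl⟩ : ∃ d, m = 3 * s + d := ⟨m - 3 * s, by omega⟩
  calc ‖π‖ ^ (3 * s + d) * (3 : ℝ) ^ s = ‖π‖ ^ d * (‖π‖ ^ (3 * s) * (3 : ℝ) ^ s) := by ring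
    _ = ‖π‖ ^ d := by rw [hkey, mul_one]
    _ ≤ ‖π‖ ^ 2 := pow_le_pow_of_le_one h0 h1 (by omega)

/-- `‖a • 1‖ = ‖a‖`, `‖a • π‖ = ‖a‖·‖π‖`, `‖a • π²‖ = ‖a‖·‖π‖²` for `a ∈ ℚ₃`. [cite: NeukirchANT1999, Ch. II (5.5)] -/
theorem norm_smul_one (a : ℚ_[3]) : ‖a • (1 : K)‖ = ‖a‖ := by
  rw [norm_smul, norm_one, mul_one]

/-- The cube of `‖a‖·‖π‖^i` is `3^{−(3·ord(a) + i)}` (`a ≠ 0`). [cite: NeukirchANT1999, Ch. II (5.5)] -/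
theorem norm_smul_pi_pow_cube (hπ : π ^ 3 = 3) {a : ℚ_[3]} (ha : a ≠ 0) (i : ℕ) :
    (‖a‖ * ‖π‖ ^ i) ^ 3 = (3 : ℝ) ^ (-(3 * a.valuation + i)) := by
  have h3 : ((3 : ℕ) : ℝ) = 3 := by norm_num
  rw [Padic.norm_eq_zpow_neg_valuation ha, h3, mul_pow, ← pow_mul, mul_comm i 3, pow_mul,
    norm_pi_pow_three hπ, ← zpow_natCast ((3 : ℝ) ^ (-a.valuation)) 3, ← zpow_mul, inv_pow,
    ← zpow_natCast (3 : ℝ) i, ← zpow_neg, ← zpow_add₀ (by norm_num : (3 : ℝ) ≠ 0)]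
  congr 1
  push_cast
  ring

/-- Pairwise distinctness of the absolute values `‖a‖·‖π‖^i` (`i = 0, 1, 2`, `a ≠ 0`): the exponents are
distinct modulo `3`. [cite: NeukirchANT1999, Ch. II (5.5)] -/
theorem norm_smul_pi_pow_ne (hπ : π ^ 3 = 3) {a a' : ℚ_[3]} (ha : a ≠ 0) (ha' : a' ≠ 0) {i j : ℕ}
    (hi : i < 3) (hj : j < 3) (hij : i ≠ j) : ‖a‖ * ‖π‖ ^ i ≠ ‖a'‖ * ‖π‖ ^ j := by
  intro h
  have h3 := congrArg (fun x : ℝ => x ^ 3) h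
  simp only [norm_smul_pi_pow_cube hπ ha, norm_smul_pi_pow_cube hπ ha'] at h3
  have hinj := zpow_right_injective₀ (by norm_num : (0 : ℝ) < 3) (by norm_num : (3 : ℝ) ≠ 1) h3
  omega

omit [NormedAlgebra ℚ_[3] K] in
/-- `‖x + y‖ = max ‖x‖ ‖y‖` if one of them vanishes or their absolute values differ.
[cite: NeukirchANT1999, Ch. II (5.5)] -/
theorem norm_add_eq_max_of [IsUltrametricDist K] (x y : K) (h : x = 0 ∨ y = 0 ∨ ‖x‖ ≠ ‖y‖) :
    ‖x + y‖ = max ‖x‖ ‖y‖ := by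
  rcases h with rfl | rfl | h
  · rw [zero_add, norm_zero, max_eq_right (norm_nonneg _)]
  · rw [add_zero, norm_zero, max_eq_left (norm_nonneg _)]
  · exact IsUltrametricDist.norm_add_eq_max_of_norm_ne_norm h

/-- **`‖a + bπ + cπ²‖ = max(‖a‖, ‖b‖·‖π‖, ‖c‖·‖π‖²)`** (`a, b, c ∈ ℚ₃`). [cite: NeukirchANT1999, Ch. II (5.5)] -/
theorem norm_combo [IsUltrametricDist K] (hπ : π ^ 3 = 3) (a b c : ℚ_[3]) :
    ‖a • (1 : K) + b • π + c • π ^ 2‖ = max ‖a‖ (max (‖b‖ * ‖π‖) (‖c‖ * ‖π‖ ^ 2)) := by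
  have hX : ‖a • (1 : K)‖ = ‖a‖ := norm_smul_one a
  have hY : ‖b • π‖ = ‖b‖ * ‖π‖ := norm_smul b π
  have hZ : ‖c • π ^ 2‖ = ‖c‖ * ‖π‖ ^ 2 := by rw [norm_smul, norm_pow]
  have hX' : ‖a • (1 : K)‖ = ‖a‖ * ‖π‖ ^ 0 := by rw [hX, pow_zero, mul_one]
  have hY' : ‖b • π‖ = ‖b‖ * ‖π‖ ^ 1 := by rw [hY, pow_one]
  have hYZ : ‖b • π + c • π ^ 2‖ = max (‖b‖ * ‖π‖) (‖c‖ * ‖π‖ ^ 2) := by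
    rw [← hY, ← hZ]
    apply norm_add_eq_max_of
    by_cases hb : b = 0
    · left; rw [hb, zero_smul]
    by_cases hc : c = 0
    · right; left; rw [hc, zero_smul]
    right; right
    rw [hY', hZ]
    exact norm_smul_pi_pow_ne hπ hb hc (by norm_num) (by norm_num) (by norm_num)
  rw [add_assoc, norm_add_eq_max_of, hX, hYZ]
  by_cases ha : a = 0
  · left; rw [ha, zero_smul]
  by_cases hb : b = 0
  · by_cases hc : c = 0
    · right; left; rw [hb, hc, zero_smul, zero_smul, add_zero]
    · right; right
      rw [hYZ, hb, norm_zero, zero_mul, max_eq_right (by positivity), hX']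
      exact norm_smul_pi_pow_ne hπ ha hc (by norm_num) (by norm_num) (by norm_num)
  · right; right
    rw [hYZ, hX']
    rcases le_total (‖b‖ * ‖π‖) (‖c‖ * ‖π‖ ^ 2) with hle | hle
    · rw [max_eq_right hle]
      by_cases hc : c = 0
      · rw [hc, norm_zero, zero_mul] at hle
        have : 0 < ‖b‖ * ‖π‖ := mul_pos (norm_pos_iff.mpr hb) (norm_pi_pos hπ)
        exact absurd hle (not_le.mpr this)
      · exact norm_smul_pi_pow_ne hπ ha hc (by norm_num) (by norm_num) (by norm_num)
    · rw [max_eq_left hle]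
      have h := norm_smul_pi_pow_ne hπ ha hb (i := 0) (j := 1) (by norm_num) (by norm_num) (by norm_num)
      simpa using h

/-! ### Integrality of `ℚ₃`-coefficients from size bounds -/

/-- `‖a‖ < 1 ⇒ ‖a‖ ≤ 1/3` in `ℚ₃`. [cite: NeukirchANT1999, Ch. II (5.5)] -/
theorem padicNorm_le_third_of_lt_one {a : ℚ_[3]} (h : ‖a‖ < 1) : ‖a‖ ≤ 3⁻¹ := by
  have := (Padic.norm_le_pow_iff_norm_lt_pow_add_one a (-1)).mpr (by simpa using h)
  simpa using this

/-- `1 < ‖a‖ ⇒ 3 ≤ ‖a‖` in `ℚ₃`. [cite: NeukirchANT1999, Ch. II (5.5)] -/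
theorem three_le_padicNorm_of_one_lt {a : ℚ_[3]} (h : 1 < ‖a‖) : 3 ≤ ‖a‖ := by
  refine le_of_not_gt fun hlt => ?_
  have := (Padic.norm_le_pow_iff_norm_lt_pow_add_one a 0).mpr (by simpa using hlt)
  simp at this
  linarith

/-- `‖a‖·‖π‖ < 1 ⇒ ‖a‖ ≤ 1` (`3·‖π‖ > 1`). [cite: NeukirchANT1999, Ch. II (5.5)] -/
theorem padicNorm_le_one_of_mul_norm_pi_lt (hπ : π ^ 3 = 3) {a : ℚ_[3]} (h : ‖a‖ * ‖π‖ < 1) :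
    ‖a‖ ≤ 1 := by
  refine le_of_not_gt fun hgt => ?_
  have h3 := three_le_padicNorm_of_one_lt hgt
  have h3r : 1 < 3 * ‖π‖ := by
    refine lt_of_not_ge fun hle => ?_
    have h' : (3 * ‖π‖) ^ 3 ≤ 1 := pow_le_one₀ (by positivity) hle
    rw [mul_pow, norm_pi_pow_three hπ] at h'
    norm_num at h'
  have : 3 * ‖π‖ ≤ ‖a‖ * ‖π‖ := mul_le_mul_of_nonneg_right h3 (norm_nonneg _)
  linarith

/-- `‖a‖·‖π‖² < 1 ⇒ ‖a‖ ≤ 1` (`3·‖π‖² > 1`). [cite: NeukirchANT1999, Ch. II (5.5)] -/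
theorem padicNorm_le_one_of_mul_norm_pi_sq_lt (hπ : π ^ 3 = 3) {a : ℚ_[3]}
    (h : ‖a‖ * ‖π‖ ^ 2 < 1) : ‖a‖ ≤ 1 := by
  refine le_of_not_gt fun hgt => ?_
  have h3 := three_le_padicNorm_of_one_lt hgt
  have h3r : 1 < 3 * ‖π‖ ^ 2 := by
    refine lt_of_not_ge fun hle => ?_
    have h' : (3 * ‖π‖ ^ 2) ^ 3 ≤ 1 := pow_le_one₀ (by positivity) hle
    rw [mul_pow, ← pow_mul, show 2 * 3 = 3 * 2 by norm_num, pow_mul, norm_pi_pow_three hπ] at h'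
    norm_num at h'
  have : 3 * ‖π‖ ^ 2 ≤ ‖a‖ * ‖π‖ ^ 2 := mul_le_mul_of_nonneg_right h3 (by positivity)
  linarith

/-- `‖a‖ ≤ ‖π‖² ⇒ ‖a‖ ≤ 1/3`. [cite: NeukirchANT1999, Ch. II (5.5)] -/
theorem padicNorm_le_third_of_le_norm_pi_sq (hπ : π ^ 3 = 3) {a : ℚ_[3]} (h : ‖a‖ ≤ ‖π‖ ^ 2) :
    ‖a‖ ≤ 3⁻¹ :=
  padicNorm_le_third_of_lt_one (h.trans_lt (norm_pi_sq_lt_one hπ))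

/-- `‖a‖·‖π‖ ≤ ‖π‖² ⇒ ‖a‖ ≤ 1/3`. [cite: NeukirchANT1999, Ch. II (5.5)] -/
theorem padicNorm_le_third_of_mul_le_norm_pi_sq (hπ : π ^ 3 = 3) {a : ℚ_[3]}
    (h : ‖a‖ * ‖π‖ ≤ ‖π‖ ^ 2) : ‖a‖ ≤ 3⁻¹ := by
  apply padicNorm_le_third_of_lt_one
  have h0 := norm_pi_pos hπ
  have : ‖a‖ ≤ ‖π‖ := by
    rw [pow_two] at h
    exact le_of_mul_le_mul_right h h0
  exact this.trans_lt (norm_pi_lt_one hπ)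

/-! ### Coordinates with respect to the basis `(1, π, π²)` -/

section Basis

variable (B : Module.Basis (Fin 3) ℚ_[3] K)

/-- `x = x₀·1 + x₁·π + x₂·π²` with `xᵢ = B.repr x i`. [cite: NeukirchANT1999, Ch. II (5.5)] -/
theorem eq_combo (hB0 : B 0 = 1) (hB1 : B 1 = π) (hB2 : B 2 = π ^ 2) (x : K) :
    x = B.repr x 0 • (1 : K) + B.repr x 1 • π + B.repr x 2 • π ^ 2 := by
  have h := B.sum_repr x
  rw [Fin.sum_univ_three, hB0, hB1, hB2] at h
  exact h.symm

/-- Coordinates of `1`. [cite: NeukirchANT1999, Ch. II (5.5)] -/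
theorem repr_one (hB0 : B 0 = 1) : B.repr 1 = Finsupp.single 0 1 := by rw [← hB0, B.repr_self]

/-- Coordinates of `π`. [cite: NeukirchANT1999, Ch. II (5.5)] -/
theorem repr_pi (hB1 : B 1 = π) : B.repr π = Finsupp.single 1 1 := by rw [← hB1, B.repr_self]

/-- Coordinates of `π²`. [cite: NeukirchANT1999, Ch. II (5.5)] -/
theorem repr_pi_sq (hB2 : B 2 = π ^ 2) : B.repr (π ^ 2) = Finsupp.single 2 1 := by
  rw [← hB2, B.repr_self]

/-- **The norm in coordinates**: `‖x‖ = max(‖x₀‖, ‖x₁‖·‖π‖, ‖x₂‖·‖π‖²)`. [cite: NeukirchANT1999, Ch. II (5.5)] -/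
theorem norm_eq_max [IsUltrametricDist K] (hπ : π ^ 3 = 3) (hB0 : B 0 = 1) (hB1 : B 1 = π)
    (hB2 : B 2 = π ^ 2) (x : K) :
    ‖x‖ = max ‖B.repr x 0‖ (max (‖B.repr x 1‖ * ‖π‖) (‖B.repr x 2‖ * ‖π‖ ^ 2)) := by
  conv_lhs => rw [eq_combo B hB0 hB1 hB2 x]
  exact norm_combo hπ _ _ _

/-- Coordinate bounds: `‖x₀‖ ≤ ‖x‖`, `‖x₁‖·‖π‖ ≤ ‖x‖`, `‖x₂‖·‖π‖² ≤ ‖x‖`. [cite: NeukirchANT1999, Ch. II (5.5)] -/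
theorem norm_repr_le [IsUltrametricDist K] (hπ : π ^ 3 = 3) (hB0 : B 0 = 1) (hB1 : B 1 = π)
    (hB2 : B 2 = π ^ 2) (x : K) :
    ‖B.repr x 0‖ ≤ ‖x‖ ∧ ‖B.repr x 1‖ * ‖π‖ ≤ ‖x‖ ∧ ‖B.repr x 2‖ * ‖π‖ ^ 2 ≤ ‖x‖ := by
  rw [norm_eq_max B hπ hB0 hB1 hB2 x]
  exact ⟨le_max_left _ _, (le_max_left _ _).trans (le_max_right _ _),
    (le_max_right _ _).trans (le_max_right _ _)⟩

/-- **The functional `ψ = x₀ − x₁` is `3`-integral on `𝔪²`**: `‖x‖ ≤ ‖π‖² ⇒ ‖ψ(x)‖ ≤ 1/3`.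
[cite: NeukirchANT1999, Ch. II (5.5)] -/
theorem norm_psi_le_of_norm_le [IsUltrametricDist K] (hπ : π ^ 3 = 3) (hB0 : B 0 = 1) (hB1 : B 1 = π)
    (hB2 : B 2 = π ^ 2) {x : K} (hx : ‖x‖ ≤ ‖π‖ ^ 2) :
    ‖(B.coord 0 - B.coord 1) x‖ ≤ 3⁻¹ := by
  obtain ⟨h0, h1, -⟩ := norm_repr_le B hπ hB0 hB1 hB2 x
  rw [LinearMap.sub_apply, B.coord_apply, B.coord_apply, sub_eq_add_neg]
  refine (IsUltrametricDist.norm_add_le_max _ _).trans (max_le ?_ ?_)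
  · exact padicNorm_le_third_of_le_norm_pi_sq hπ (h0.trans hx)
  · rw [norm_neg]
    exact padicNorm_le_third_of_mul_le_norm_pi_sq hπ (h1.trans hx)

/-- `ψ(1) = 1`. [cite: NeukirchANT1999, Ch. II (5.5)] -/
theorem psi_one (hB0 : B 0 = 1) : (B.coord 0 - B.coord 1) (1 : K) = 1 := by
  rw [LinearMap.sub_apply, B.coord_apply, B.coord_apply, repr_one B hB0]
  simp

/-- `ψ(π) = −1`. [cite: NeukirchANT1999, Ch. II (5.5)] -/
theorem psi_pi (hB1 : B 1 = π) : (B.coord 0 - B.coord 1) π = -1 := by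
  rw [LinearMap.sub_apply, B.coord_apply, B.coord_apply, repr_pi B hB1]
  simp

/-- `ψ(π²) = 0`. [cite: NeukirchANT1999, Ch. II (5.5)] -/
theorem psi_pi_sq (hB2 : B 2 = π ^ 2) : (B.coord 0 - B.coord 1) (π ^ 2) = 0 := by
  rw [LinearMap.sub_apply, B.coord_apply, B.coord_apply, repr_pi_sq B hB2]
  simp

end Basis

/-! ### Coordinates of `1`, `π`, `π²`, one index at a time -/

section Coords

variable (B : Module.Basis (Fin 3) ℚ_[3] K)

/-- `(1)₀ = 1`. [cite: NeukirchANT1999, Ch. II (5.5)] -/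
theorem repr_one_zero (hB0 : B 0 = 1) : B.repr 1 0 = 1 := by simp [repr_one B hB0]
/-- `(1)₁ = 0`. [cite: NeukirchANT1999, Ch. II (5.5)] -/
theorem repr_one_one (hB0 : B 0 = 1) : B.repr 1 1 = 0 := by simp [repr_one B hB0]
/-- `(1)₂ = 0`. [cite: NeukirchANT1999, Ch. II (5.5)] -/
theorem repr_one_two (hB0 : B 0 = 1) : B.repr 1 2 = 0 := by simp [repr_one B hB0]
/-- `(π)₀ = 0`. [cite: NeukirchANT1999, Ch. II (5.5)] -/
theorem repr_pi_zero (hB1 : B 1 = π) : B.repr π 0 = 0 := by simp [repr_pi B hB1]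
/-- `(π)₁ = 1`. [cite: NeukirchANT1999, Ch. II (5.5)] -/
theorem repr_pi_one (hB1 : B 1 = π) : B.repr π 1 = 1 := by simp [repr_pi B hB1]
/-- `(π)₂ = 0`. [cite: NeukirchANT1999, Ch. II (5.5)] -/
theorem repr_pi_two (hB1 : B 1 = π) : B.repr π 2 = 0 := by simp [repr_pi B hB1]
/-- `(π²)₀ = 0`. [cite: NeukirchANT1999, Ch. II (5.5)] -/
theorem repr_pi_sq_zero (hB2 : B 2 = π ^ 2) : B.repr (π ^ 2) 0 = 0 := by simp [repr_pi_sq B hB2]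
/-- `(π²)₁ = 0`. [cite: NeukirchANT1999, Ch. II (5.5)] -/
theorem repr_pi_sq_one (hB2 : B 2 = π ^ 2) : B.repr (π ^ 2) 1 = 0 := by simp [repr_pi_sq B hB2]
/-- `(π²)₂ = 1`. [cite: NeukirchANT1999, Ch. II (5.5)] -/
theorem repr_pi_sq_two (hB2 : B 2 = π ^ 2) : B.repr (π ^ 2) 2 = 1 := by simp [repr_pi_sq B hB2]

/-- `1/3·‖π‖ ≤ ‖π‖²` (`= ‖π‖⁴ ≤ ‖π‖²`). [cite: NeukirchANT1999, Ch. II (5.5)] -/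
theorem third_mul_norm_pi_le_sq (hπ : π ^ 3 = 3) : 3⁻¹ * ‖π‖ ≤ ‖π‖ ^ 2 := by
  have h0 := norm_pi_pos hπ
  have h := (third_lt_norm_pi_sq hπ).le
  nlinarith [norm_pi_lt_one hπ]

/-- A sufficient coordinate criterion for `‖x‖ ≤ ‖π‖²`: `‖x₀‖ ≤ 1/3`, `‖x₁‖ ≤ 1/3`, `‖x₂‖ ≤ 1`.
[cite: NeukirchANT1999, Ch. II (5.5)] -/
theorem norm_le_sq_of_repr [IsUltrametricDist K] (hπ : π ^ 3 = 3) (hB0 : B 0 = 1) (hB1 : B 1 = π)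
    (hB2 : B 2 = π ^ 2) {x : K} (h0 : ‖B.repr x 0‖ ≤ 3⁻¹) (h1 : ‖B.repr x 1‖ ≤ 3⁻¹)
    (h2 : ‖B.repr x 2‖ ≤ 1) : ‖x‖ ≤ ‖π‖ ^ 2 := by
  rw [norm_eq_max B hπ hB0 hB1 hB2 x]
  refine max_le (h0.trans (third_lt_norm_pi_sq hπ).le) (max_le ?_ ?_)
  · exact (mul_le_mul_of_nonneg_right h1 (norm_nonneg _)).trans (third_mul_norm_pi_le_sq hπ)
  · exact (mul_le_mul_of_nonneg_right h2 (sq_nonneg _)).trans (by rw [one_mul])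

end Coords

/-! ### `(1, π, π²)` is linearly independent over `ℚ₃` -/

/-- `1, π, π²` are `ℚ₃`-linearly independent (their `ℚ₃`-multiples have pairwise distinct absolute values),
so they form a basis as soon as `[K : ℚ₃] = 3`. [cite: NeukirchANT1999, Ch. II (5.5)] -/
theorem linearIndependent_one_pi_pi_sq [IsUltrametricDist K] (hπ : π ^ 3 = 3) :
    LinearIndependent ℚ_[3] ![(1 : K), π, π ^ 2] := by
  rw [Fintype.linearIndependent_iff]
  intro g hg
  have hg' : g 0 • (1 : K) + g 1 • π + g 2 • π ^ 2 = 0 := by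
    simpa [Fin.sum_univ_three] using hg
  have h := norm_combo hπ (g 0) (g 1) (g 2)
  rw [hg', norm_zero] at h
  have h0 : ‖g 0‖ ≤ 0 := by rw [h]; exact le_max_left _ _
  have h1 : ‖g 1‖ * ‖π‖ ≤ 0 := by rw [h]; exact (le_max_left _ _).trans (le_max_right _ _)
  have h2 : ‖g 2‖ * ‖π‖ ^ 2 ≤ 0 := by rw [h]; exact (le_max_right _ _).trans (le_max_right _ _)
  have hπ0 := norm_pi_pos hπ
  have e0 : g 0 = 0 := norm_le_zero_iff.mp h0
  have e1 : g 1 = 0 := norm_le_zero_iff.mp (le_of_mul_le_mul_right (by simpa using h1) hπ0)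
  have e2 : g 2 = 0 :=
    norm_le_zero_iff.mp (le_of_mul_le_mul_right (by simpa using h2) (pow_pos hπ0 2))
  intro i
  fin_cases i
  · exact e0
  · exact e1
  · exact e2

end WildCubic

end Literature.IUT.LogVolume

end
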